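import Literature.Algebra.Homology.DiscreteRepCoresRes
import Literature.Algebra.Homology.DiscreteRepRestrictionExact
import HarnessLib

/-!
# The invariant map and corestriction: `inv_Γ ∘ cores_U = inv_U` from `inv_U ∘ res_U = [Γ : U] • inv_Γ`

Topic `Algebra/Homology`; namespace `Literature.Algebra.Homology.DiscreteRep`.  Theorems only; no
definition, no named fact, no instance, no `sorry`.  Sequel of `DiscreteRepCoresRes`
(`extRes`, `extCores`, `cores ∘ res = [Γ : U] •`).

In a class formation `(G, C)` the local invariant maps satisfy `inv_U ∘ Res = [G : U] · inv_G`
(Milne ADT I §1, the axiom (1.1 (b)); Harari Def. 16.3) and CONSEQUENTLY `inv_G ∘ Cor = inv_U`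
(because `Res` is onto `H²(U, C) ≅ ℚ/ℤ` and `Cor ∘ Res = [G : U]`).  The duality theorem of
`DiscreteRepTateDuality` is phrased with `invAt U = inv_Γ ∘ cores_U`; this file derives its
bijectivity from the `Res`-form of the axiom, which is the form the idèle-class computations of the
cell produce (restriction of invariants at finite layers).  For `Γ` a topological group, `U ≤ Γ` open
of finite index, `C ∈ C_Γ = DiscreteRepCat k Γ`, additive maps `invΓ : Ext²_Γ(k, C) →+ Q`,
`invU : Ext²_U(k, Res C) →+ Q`:

* `extRes_surjective_of_inv`: if `invU (res x) = [Γ:U] • invΓ x`, `invU` is injective, `invΓ` is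
  surjective and `Q` is `[Γ:U]`-divisible, then `res : Ext²_Γ(k, C) → Ext²_U(k, Res C)` is onto;
* **`inv_comp_extCores_eq`**: under the same hypotheses `invΓ (cores y) = invU y` for all `y`;
* **`bijective_inv_comp_extCores`**: hence `invΓ ∘ cores_U` is bijective as soon as `invU` is.

Written for Route A of the Poitou–Tate programme of crux `stmt-BirchSwinnertonDyer-19295` (cell
`bsd-schneider-ideate`, seat door-c4 gen 15): discharges the shape of the hypothesis
`TateDualityHypotheses.invAt_bijective`.  HONEST FRAMING: homological algebra only.

## References
* J. S. Milne, *Arithmetic Duality Theorems* (2nd ed. 2006), I §1 (class formations, (1.1)). [MilneADT2006]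
* D. Harari, *Galois Cohomology and Class Field Theory*, Universitext (2020), §16.1 Definition 16.3 and
  the remarks following it (`inv_V ∘ Res = [U:V] inv_U`, `inv_U ∘ Cores = inv_V`). [Harari2020]
-/

noncomputable section

universe w' u

namespace Literature.Algebra.Homology

namespace DiscreteRep

open CategoryTheory CategoryTheory.Limits CategoryTheory.Abelian

variable {k Γ : Type u} [CommRing k] [Group Γ] [TopologicalSpace Γ] [IsTopologicalGroup Γ]
  (U : Subgroup Γ) (hU : IsOpen (U : Set Γ)) [U.FiniteIndex] (C : DiscreteRepCat k Γ)
  {Q : Type w'} [AddCommGroup Q] {n : ℕ}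
  (invΓ : Ext (triv (k := k) (Γ := Γ) k) C n →+ Q)
  (invU : Ext ((resD k U).obj (triv (k := k) (Γ := Γ) k)) ((resD k U).obj C) n →+ Q)

omit [U.FiniteIndex] in
/-- **`res` is onto in the degree where the invariants live**: if `invU (res x) = [Γ:U] • invΓ x`,
`invU` is injective, `invΓ` is surjective and `Q` is `[Γ:U]`-divisible, every class of
`Extⁿ_U(k, Res C)` is a restriction. [cite: MilneADT2006, I §1 (1.1)][cite: Harari2020, §16.1 Definition 16.3] -/
theorem extRes_surjective_of_inv
    (hres : ∀ x, invU (extRes U (triv (k := k) (Γ := Γ) k) C n x) = U.index • invΓ x)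
    (hinjU : Function.Injective invU) (hsurjΓ : Function.Surjective invΓ)
    (hdiv : ∀ q : Q, ∃ q' : Q, q = U.index • q') :
    Function.Surjective (extRes U (triv (k := k) (Γ := Γ) k) C n) := fun y => by
  obtain ⟨q', hq'⟩ := hdiv (invU y)
  obtain ⟨x, hx⟩ := hsurjΓ q'
  refine ⟨x, hinjU ?_⟩
  rw [hres, hx, ← hq']

/-- **`inv_Γ ∘ cores_U = inv_U`** under the `Res`-form of the class-formation axiom (and `invU`
injective, `invΓ` surjective, `Q` divisible by the index): `cores ∘ res = [Γ:U] •` and `res` onto.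
[cite: MilneADT2006, I §1 (1.1)][cite: Harari2020, §16.1 Definition 16.3] -/
theorem inv_comp_extCores_eq
    (hres : ∀ x, invU (extRes U (triv (k := k) (Γ := Γ) k) C n x) = U.index • invΓ x)
    (hinjU : Function.Injective invU) (hsurjΓ : Function.Surjective invΓ)
    (hdiv : ∀ q : Q, ∃ q' : Q, q = U.index • q')
    (y : Ext ((resD k U).obj (triv (k := k) (Γ := Γ) k)) ((resD k U).obj C) n) :
    invΓ (extCores U hU C n y) = invU y := by
  obtain ⟨x, rfl⟩ := extRes_surjective_of_inv U C invΓ invU hres hinjU hsurjΓ hdiv y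
  rw [extCores_extRes_eq_nsmul, map_nsmul, hres]

/-- **`inv_Γ ∘ cores_U` is bijective when `inv_U` is** (and the `Res`-axiom holds, `invΓ` is onto,
`Q` divisible by the index) — the hypothesis `invAt_bijective` of the duality theorem in the form the
class-field-theoretic computations deliver. [cite: MilneADT2006, I §1 (1.1)][cite: Harari2020, §16.1 Definition 16.3] -/
theorem bijective_inv_comp_extCores
    (hres : ∀ x, invU (extRes U (triv (k := k) (Γ := Γ) k) C n x) = U.index • invΓ x)
    (hbijU : Function.Bijective invU) (hsurjΓ : Function.Surjective invΓ)
    (hdiv : ∀ q : Q, ∃ q' : Q, q = U.index • q') :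
    Function.Bijective (invΓ.comp (extCores U hU C n)) := by
  have key : invΓ.comp (extCores U hU C n) = invU :=
    AddMonoidHom.ext fun y => inv_comp_extCores_eq U hU C invΓ invU hres hbijU.1 hsurjΓ hdiv y
  rw [key]
  exact hbijU

/-- Conversely the `Cores`-form gives back the `Res`-form: `invΓ (cores (res x)) = [Γ:U] • invΓ x`
(no hypothesis). [cite: Harari2020, §16.1 Definition 16.3] -/
theorem inv_extCores_extRes (x : Ext (triv (k := k) (Γ := Γ) k) C n) :
    invΓ (extCores U hU C n (extRes U (triv (k := k) (Γ := Γ) k) C n x)) = U.index • invΓ x := by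
  rw [extCores_extRes_eq_nsmul, map_nsmul]

end DiscreteRep

end Literature.Algebra.Homology
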